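import Summits.Schanuel.Schanuel.Theorems.RootDecomp1KHeightGrading02
import Literature.NumberTheory.DiophantineGeometry.PlaneCurveBezoutWeak
import Mathlib.RingTheory.Polynomial.RationalRoot

/-!
# RootDecomp1KSiegelFunctions — lens 1, generation 71, NODE 31 «THE HEIGHT BINDER HALVED: `HeightComparison ⟸ SiegelFunctionsAll`, ARITHMETIC HALF PROVED» (×0-AS-RECORD + one contingent ×1 at FLOOR G (a) — PRICE 31 L3149, RULING L3160, NODE L3172, VERDICT L3175): the node-12 hypothesis binder `HeightComparison` (Weil–Siegel height comparison on a plane curve) is, definitionally, `∀ P, GeomIrreducible P → 1 ≤ xdeg P → 1 ≤ deg_Y P → HeightComparisonAt P`, and `heightComparisonAt_of_siegelFunctions` PROVES `HeightComparisonAt P` from the GEOMETRIC datum `SiegelFunctions P ∧ SiegelFunctions (swap P)` (two integral functions of controlled degree for every b ≥ 1); the ARITHMETIC half (rational-root integrality, archimedean root bound, `h(y^b) = b·h(y)`, finite exceptional fibres by Bezout, exchange of variables) is proved sorry-free; hence `heightComparison_of_siegelFunctionsAll : SiegelFunctionsAll → HeightComparison` and the node-12 heads re-pointed BY NAME; the geometric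 half `SiegelFunctionsAll` is a typed HYPOTHESIS (plan S1–S6 in the docstring of `SiegelFunctions`), NOT proved; (G)-instances by hand: `parabP` / its transpose / `hyperbP`, and the infinite family 𝒞₃ = {(x·Y − 1)² − f(x) : f cubic, f(0) ≠ 1} in BOTH charts (Lucas trace; the 3 × 3 POWER LEMMA), its geometric irreducibility, and the HYPOTHESIS-FREE `heightComparisonAt_sqLinP` / `thinFibreAt_two_sqLinP` — ×0-AS-RECORD toolkit per RULING L3160 (every 𝒞₃ member is also decided by the numerator lever); `PadicSubspace`, items 33364 / 33363 / 31077 / 31987 and the tally UNMOVED — part 1 (RootDecomp1KSiegelFunctions01): §0  Definitions: the `ℚ`-model, monic relations on the curve, the geometric binder · §1  The `ℚ`-model: evaluation and divisibility bookkeeping — 25 declarations `ratModel` … `evalEval_ratModel_relPoly`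

(lens-1 g71 NODE 31 «THE HEIGHT BINDER HALVED» L3172: HOME kernel K = HOME/decomp-schanuel-lens-1/g71/lean/SiegelFunctions.lean sha256 4f39c136…, 1983 l, 207 decls (173 theorems + 34 defs by the critic's count, VERDICT L3175; NODE's «208» an e-lite), ONE namespace `Summit.Schanuel.Schanuel.Theorems.RootDecomp1KSiegelFunctions` (inner anonymous-free sections `PowerLemma` / `Chart2` / `GeomIrreducible` with their `variable`s kept whole inside one part each), imports EXACTLY the tree port …RootDecomp1KHeightGrading02 (node 12: `HeightComparison`, `HeightDecidedAt`, `GeomIrreducible`, `logHt` BY TREE NAME) + `Literature.NumberTheory.DiophantineGeometry.PlaneCurveBezoutWeak` + `Mathlib.RingTheory.Polynomial.RationalRoot`; no private / instance / set_option / notation / sorry / new axiom / native_decide / [cite; lens farm rc 0 · 0 errors · 0 sorries · dupNamespace warnings only; `#print axioms` = [propext, Classical.choice, Quot.sound] on the nine probed heads (g71/out/ax_*.json), Probe g71/out/ProbeK.lean 2659bdec… rc 0 (rfl pin `HeightComparison` = tree), CONTROLS A / A0 / B rc 1 as designed (ctrlA 4ae3a6d6… / ctrlA0 ff875685… / ctrlB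 f20add70…), memo g71/NODE-g71.md 07fb49f8…, SHA256SUMS 34 files; CLAIM 31 L3146; crit PRICE 31 L3149 (×0-as-record + one contingent ×1 at FLOOR G; CHECKLIST K-g71; RULES K-R59 / K-R60 pre-announced); lens ASK-FIRST FAMILY CLAIM L3158 (𝒞₃) and crit RULING L3160 (𝒞₃ REFUSED as a FLOOR-G (b) family: numerator lever, NUMEXP; toolkit ×0 under K-R60 (i)); census INSTRUMENT NOTES 54–56 L3161 / L3163 / L3167 (LIVENESS-v46 / v47 / v48: rows 75–77 = 𝒞₃ members, keys numexp / numexp_tight / k60) and crit ACKs L3165 / L3168; writer NOTES 4 / 5 L3162 / L3173; crit-1 (g13) VERDICT 31 L3175: «NODE 31 = ×0-AS-RECORD BOOKED; CHECKLIST K-g71 (J1)–(J7) MET; the contingent THEOREM ×1 REGISTERED under K-R59 (ii), UNPAID (FLOOR G unmet); RULES K-R59 and K-R60 (i)–(iv) FIXED; PORT GO» — kernel re-verified by the critic (farm rc 0 · 0 errors · 0 sorries; 207 decls = 173 theorems + 34 defs; axioms standard re-probed on 27 heads), record: piece C227 «HeightComparison ⟸ SiegelFunctionsAll», the K-line binder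 HeightComparison henceforth CONSUMED through heightComparison_of_siegelFunctionsAll (Dom re-pointing BY NAME, antecedent count unchanged), 𝒞₃ / InC3 decided hypothesis-free by thinFibreAt_of_inC3 / thinFibreAt_two_sqLinP = the K-R60 (i) kernel shape (TOOLKIT, ×0, never payable), tally UNCHANGED lens-1 ×22 + THEOREM ×24, EXHIBITS ρ1 / ρ2 VACANT, 33364 / 33363 / 31077 / 31987 OPEN rung 0. Port by census-1 gen 26 as `RootDecomp1KSiegelFunctions01–09` (files ≤ 400 lines; chain 01 ← the three K imports, 0k ← 0(k−1); `--supports stmt-Schanuel-33364`, the item stays OPEN; ×0 record port — the geometric binder `SiegelFunctions` / `SiegelFunctionsAll` appears ONLY as an explicit hypothesis of the `…_of_siegelFunctions…` heads, never an axiom / instance / variable; no credit anywhere; the section-aligned 9-part split is lens-1's port plan (J7) re-built by the census pipeline): 01 = K-port l.1–216 (§0 / §1) — 25 decls `ratModel`, `QDvd`, `relPoly`, …, `evalEval_ratModel_relPoly`; 02 = K-port l.219–446 (§2) — 20 decls `scaledEval`, `l1`, `l1_nonneg`, …, `abs_le_of_rel`; 03 = K-port l.449–654 (§3 / §4) — 9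 decls `HtQ_pow`, `logHt_pow`, `HtQ_intDiv_le`, …, `upperComparisonAt_of_siegelFunctions`; 04 = K-port l.657–826 (§5) — 13 decls `coeff_coeff_swap`, `map_swap`, `natDegree_swap`, …, `heightComparison_of_siegelFunctions`; 05 = K-port l.829–1101 (§6 / §7) — 28 decls `thinFibreAt_of_heightComparisonAt`, `thinFibreAt_of_heightComparison'`, `thinFibreAt_of_siegelFunctions`, …, `siegelFunctions_toys`; 06 = K-port l.1103–1296 (§8) — 20 decls `sqLinP`, `sqLinP_eq`, `natDegree_sqLinP`, …, `thinFibreAt_sqLinP_of_swap`; 07 = K-port l.1298–1543 (§9) — 35 decls `compM`, `cubic`, `cubic_eq`, …, `natDegree_det3_compM_pow_le`; 08 = K-port l.1545–1852 (§10) — 40 decls `q₃`, `q₂`, `q₁`, …, `heightComparisonAt_sqLinP_of_geomIrreducible`; 09 = K-port l.1854–2070 (§11 / §12) — 17 decls `sqLinK`, `coeff_sqLinK`, `natDegree_sqLinK`, …, `thinFibreAt_of_inC3`. 91 one-line docstrings synthesised for undocumented helper declarations (statements quoted); everything else = K VERBATIM (statements, names, proofs, K's module docstring kept in part 01 below this provenance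 block).)
-/

/-!
# RootDecomp1KSiegelFunctions — lens 1 (grading / quantitative ladder), generation 71, NODE 31
«THE HEIGHT BINDER HALVED: `HeightComparison ⟸ SiegelFunctionsAll`, ARITHMETIC HALF PROVED»

Route of record `route-Schanuel-RootDecomp1K`, K-line item `stmt-Schanuel-33364` (`FiniteOrderLiouvilleSchanuel`,
rung 0, UNMOVED by this file).  Node 12 (`RootDecomp1KHeightGrading01/02`) reduced the K-line's residual on its
class `n < 2k` to the hypothesis binder `HeightComparison` (Weil–Siegel height comparison on a plane curve, a theorem
in print, NOT proved in the tree).  This file HALVES that binder: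

* `HeightComparison` is, definitionally, `∀ P, GeomIrreducible P → 1 ≤ xdeg P → 1 ≤ deg_Y P → HeightComparisonAt P`
  (`heightComparison_iff`), and **`heightComparisonAt_of_siegelFunctions`** PROVES `HeightComparisonAt P` from the
  purely GEOMETRIC datum `SiegelFunctions P ∧ SiegelFunctions (swap P)` (§0: for every `b ≥ 1` two functions
  `φ = G/H`, `ψ = φ·Y^b` on the curve, integral over `ℚ[x]` of degree `a` with `a·deg_Y P ≤ b·xdeg P + c` — what
  Riemann's inequality on the function field provides).  The ARITHMETIC half — rational root theorem / Gauss lemma for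
  a monic relation over `ℤ[x]` at a rational point, the archimedean root bound, `h(y^b) = b·h(y)`, the finite
  exceptional fibres (Bezout, `Literature…PlaneCurveBezoutWeak`), the exchange of variables and the two-sided
  combination — is PROVED here, sorry-free, axioms `propext, Classical.choice, Quot.sound` (§1–§5).
  Hence `heightComparison_of_siegelFunctionsAll : SiegelFunctionsAll → HeightComparison` and the node-12 heads
  re-pointed BY NAME (§6).
* The GEOMETRIC half `SiegelFunctionsAll` (§0, hypothesis) is NOT proved; the prover plan (G) S1–S6 with the named
  Literature/Mathlib declarations is in the docstring of `SiegelFunctions`.  NO Diophantine input anywhere.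
* INSTANCES of (G) proved by hand (the typed `∃` of `SiegelFunctions` is satisfiable and behaves as intended):
  §7 three explicit curves (`parabP`, its transpose, `hyperbP`); §8–§12 the INFINITE family
  `𝒞₃ = {(x·Y − 1)² − f(x) : f ∈ ℤ[x] cubic, f(0) ≠ 1}` — BOTH charts (`siegelFunctions_sqLinP`: `φ = x^b`, trace =
  Lucas sequence; `sqLinSwapSiegel`: the transposed cubic chart via the 3 × 3 POWER LEMMA §9 = step S5 of (G) in
  coordinates), its geometric irreducibility (§11), and therefore — with NO hypothesis binder at all — the height
  comparison `heightComparisonAt_sqLinP` and the thin-fibre clause `thinFibreAt_sqLinP` at every `m₀ ≥ 2` on every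
  member (§12).  HONESTY (RULING L3160 of the cell's critic): `𝒞₃` is REFUSED as a FLOOR-G (b) family — every member
  is ALSO decided by the elementary «numerator lever» (`p_N ∣ (1 − f₀)·den²`), so these unconditional theorems decide
  no live territory of record; they are ×0-AS-RECORD toolkit / (G)-instances (K-R60 (i)), and the ×1 of the
  height-binder line still awaits FLOOR G (a) `theorem heightComparison : HeightComparison` (or an admissible (b)-family).
* NOT touched: `PadicSubspace` (node 30), items 33364 / 33363 / 31077 / 31987, the census tally.
-/

noncomputable section

namespace Summit.Schanuel.Schanuel.Theorems.RootDecomp1KSiegelFunctions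

open Polynomial
open scoped Nat
open Summit.Schanuel.Schanuel.Theorems.RootDecomp1KDegreeLadder (bev xdeg natDegree_coeff_le_xdeg ThinFibreAt ThinFibre
  thinFibreAt_of_natDegree_lt)
open Summit.Schanuel.Schanuel.Theorems.RootDecomp1KHeightGrading

/-! ### §0  Definitions: the `ℚ`-model, monic relations on the curve, the geometric binder -/

/-- the `ℚ`-model of an integer plane curve `P ∈ ℤ[x][Y]`. -/
def ratModel (P : ℤ[X][X]) : ℚ[X][X] := P.map (mapRingHom (Int.castRingHom ℚ))

/-- divisibility of integer plane curves OVER `ℚ`: `P ∣ R` in `ℚ[x][Y]`. -/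
def QDvd (P R : ℤ[X][X]) : Prop := ratModel P ∣ ratModel R

/-- the RELATION POLYNOMIAL of a monic relation of formal degree `m` for the quotient `G/H`:
`H^m · (D·(G/H)^m + Σ_{i=1}^{m} χ_i(x)·(G/H)^{m-i}) = D·G^m + Σ_{i=1}^{m} χ_i(x)·G^{m-i}·H^i`. -/
def relPoly (m : ℕ) (D : ℤ) (χ : ℕ → ℤ[X]) (G H : ℤ[X][X]) : ℤ[X][X] :=
  C (C D) * G ^ m + ∑ i ∈ Finset.Icc 1 m, C (χ i) * G ^ (m - i) * H ^ i

/-- [geometric notion, elementary packaging] `G/H` IS INTEGRAL OF DEGREE `≤ a` OVER `ℚ[x]` ON THE CURVE `P = 0`: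
there is a monic relation (nonzero constant integer top coefficient `D`, lower coefficients `χ_i ∈ ℤ[x]` of degree
`≤ a·i`) satisfied by `G/H` modulo `P` over `ℚ` — i.e. the class of `G/H` in the function field `ℚ(x)[Y]/(P)` has poles
only over `x = ∞`, of (normalised) order `≤ a`. No heights, no points, no valuations in the statement. -/
def IntegralOfDegree (P : ℤ[X][X]) (a : ℕ) (G H : ℤ[X][X]) : Prop :=
  ∃ (m : ℕ) (D : ℤ) (χ : ℕ → ℤ[X]), D ≠ 0 ∧ (∀ i, (χ i).natDegree ≤ a * i) ∧ QDvd P (relPoly m D χ G H)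

/-- [hypothesis, PER CURVE] definition: **SIEGEL FUNCTIONS ON THE CURVE `P = 0`** (the geometric half of the height
comparison; what Riemann's inequality on the function field `ℚ(C)` provides).  For some constant `c` and every `b ≥ 1`
there are `a` with `a·deg_Y P ≤ b·xdeg P + c` and `G, H ∈ ℤ[x][Y]`, neither divisible by `P` over `ℚ`, such that BOTH
`φ = G/H` and `ψ = φ·Y^b = G·Y^b/H` are integral of degree `≤ a` over `ℚ[x]` on the curve.  (In the function field:
`0 ≠ φ ∈ L(a·(x)_∞ − b·(y)_∞)`, which is nonzero as soon as `a·n − b·k ≥ g` by Riemann's theorem, and then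
`φ, φ·y^b ∈ L(a·(x)_∞)`.)  NOT proved here for general `P`; used below ONLY as an explicit hypothesis (and
PROVED for the toy curves of §7 and for chart 1 of the family `(xY − 1)² − f(x)` in §8).

PROVER PLAN (G) = `SiegelFunctionsAll` (memo S1–S6; `n := deg_Y P`, `k := xdeg P`, `g :=` the genus of `ℚ(C)`;
CONSTANTS `a := ⌈(b·k + g)/n⌉`, `c := g + n − 1`, so that `a·n ≤ b·k + g + n − 1 = b·k + c`):
* S1 (model) `F := AdjoinRoot` of the monic associate of `ratModel P` over `RatFunc ℚ`; `F/ℚ` is an algebraic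
  function field with `[F : ℚ(x)] = n` —
  `Literature.NumberTheory.DiophantineGeometry.AlgFunctionField.isAlgFunctionField_of_powerBasis`,
  `….AlgFunctionField.finrank_adjoin_algebraMap_X_eq_dim` (PlaneCurveFunctionFieldProofs); `ℚ` is the full
  constant field because `P` is geometrically irreducible (PlaneCurveConstantFieldProofs).
* S2 (polar divisors) `deg (x)_∞ = [F : ℚ(x)] = n` —
  `….AlgFunctionField.sum_neg_ord_mul_degree_eq_finrank` (FunctionFieldDivisorsNegativeDegreeProofs,
  Stichtenoth 1.4.11); `deg (y)_∞ = [F : ℚ(y)] ≤ k` (the easy inequality: `y` is a root of `P(x, ·)` of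
  `x`-degree `k` over `ℚ(y)`... i.e. `x` is algebraic of degree `≤ k` over `ℚ(y)`).
* S3 (Riemann's inequality, PROVED in tree) `ℓ(D) ≥ deg D + 1 − g` —
  `Literature.NumberTheory.DiophantineGeometry.AlgFunctionField.degree_add_one_sub_ell_le_genus_holds`
  (FunctionFieldGenusRiemannTheoremProofs, Stichtenoth 1.4.17 (a)); with `D := a·(x)_∞ − b·(y)_∞`,
  `deg D = a·n − b·deg (y)_∞ ≥ a·n − b·k ≥ g`, hence `ℓ(D) ≥ 1`: pick `0 ≠ φ ∈ L(D)`.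
* S4 (divisor arithmetic) `φ ∈ L(a·(x)_∞)` and `φ·y^b ∈ L(a·(x)_∞ − b·(y)_∞ + b·(y)) ⊆ L(a·(x)_∞ + b·(y)_0)`;
  sharper: `(φ·y^b) = (φ) + b(y)_0 − b(y)_∞ ≥ −a(x)_∞ + b(y)_0 ≥ −a(x)_∞`, so `φ·y^b ∈ L(a·(x)_∞)` too.
* S5 (integer-isation = the valuation-theoretic heart) an element of `L(a·(x)_∞)` is integral over `ℚ[x]`
  (`∩_{𝔓 ∤ ∞} O_𝔓 =` integral closure of `ℚ[x]` in `F` — Mathlib `LocalSubring.iInf_valuationSubring_superset`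
  / `iInf_valuationSubring_superset`), so its minimal polynomial over `ℚ(x)` has coefficients in `ℚ[x]`
  (Mathlib `minpoly.isIntegrallyClosed_eq_field_fractions'`, `ℚ[x]` integrally closed as a UFD); the same lemma
  over the integrally closed ring `ℚ[x⁻¹]` applied to `z·x^{−a} ∈ ∩_{𝔓 ∣ ∞} O_𝔓` bounds the coefficient
  degrees: `deg_x μ_i ≤ a·i` — exactly the shape `IntegralOfDegree` (an equivalent structural form a prover may
  prefer: `IsIntegral ℚ[x] z ∧ IsIntegral ℚ[x⁻¹] (z/x^a)`, closed under products by `IsIntegral.mul`).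
* S6 (back to polynomials) `φ = G(x,y)/H(x,y)` with `G, H ∈ ℤ[x][Y]` (clear denominators), `P ∤ G`, `P ∤ H`
  over `ℚ` iff `G(x,y), H(x,y) ≠ 0` in `F` — the kernel of `ℚ[x][Y] → F` is `(P)`:
  `….AlgFunctionField.dvd_of_evalEval_eq_zero` (PlaneCurvePlacesAtPointsProofs) / `AdjoinRoot.mk_eq_zero`;
  a relation `μ(z) = 0` in `F` for `z = G/H` (resp. `G·y^b/H`) becomes `P ∣ H^m·μ(G/H) = relPoly …` over `ℚ`.
Heaviest step: S5. No Diophantine input anywhere in (G). -/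
def SiegelFunctions (P : ℤ[X][X]) : Prop :=
  ∃ c : ℕ, ∀ b : ℕ, 1 ≤ b → ∃ (a : ℕ) (G H : ℤ[X][X]),
    a * P.natDegree ≤ b * xdeg P + c ∧ ¬ QDvd P G ∧ ¬ QDvd P H ∧
    IntegralOfDegree P a G H ∧ IntegralOfDegree P a (G * X ^ b) H

/-- [hypothesis] definition: Siegel functions exist on EVERY geometrically irreducible integer plane curve of positive
degrees in both variables (the statement a prover discharges from the Literature function-field library: Riemann's
theorem `AlgFunctionField.degree_add_one_sub_ell_le_genus_holds` + valuation-theoretic integrality). -/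
def SiegelFunctionsAll : Prop :=
  ∀ P : ℤ[X][X], GeomIrreducible P → 1 ≤ xdeg P → 1 ≤ P.natDegree → SiegelFunctions P

/-- [statement def] the height comparison AT ONE CURVE — node 12's binder `HeightComparison` is, definitionally,
`∀ P, GeomIrreducible P → 1 ≤ xdeg P → 1 ≤ P.natDegree → HeightComparisonAt P` (`heightComparison_iff`). -/
def HeightComparisonAt (P : ℤ[X][X]) : Prop :=
  ∀ ε : ℝ, 0 < ε → ∃ c : ℝ, ∀ x y : ℚ, bev P x y = 0 →
    |(xdeg P : ℝ) * logHt x - (P.natDegree : ℝ) * logHt y| ≤ ε * logHt x + c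

/-- [statement def] the ONE-SIDED comparison at one curve: `n·h(y) ≤ (k + ε)·h(x) + c`. -/
def UpperComparisonAt (P : ℤ[X][X]) : Prop :=
  ∀ ε : ℝ, 0 < ε → ∃ c : ℝ, ∀ x y : ℚ, bev P x y = 0 →
    (P.natDegree : ℝ) * logHt y ≤ ((xdeg P : ℝ) + ε) * logHt x + c

/-- `: HeightComparison ↔ ∀ P : ℤ[X][X], GeomIrreducible P → 1 ≤ xdeg P → 1 ≤ P.natDegree → HeightComparisonAt P`. -/
theorem heightComparison_iff :
    HeightComparison ↔ ∀ P : ℤ[X][X], GeomIrreducible P → 1 ≤ xdeg P → 1 ≤ P.natDegree → HeightComparisonAt P :=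
  Iff.rfl

/-! ### §1  The `ℚ`-model: evaluation and divisibility bookkeeping -/

/-- `(P : ℤ[X][X]) : ratModel P = P.map (mapRingHom (Int.castRingHom ℚ))`. -/
theorem ratModel_apply (P : ℤ[X][X]) : ratModel P = P.map (mapRingHom (Int.castRingHom ℚ)) := rfl

/-- `(P R : ℤ[X][X]) : ratModel (P * R) = ratModel P * ratModel R`. -/
@[simp] theorem ratModel_mul (P R : ℤ[X][X]) : ratModel (P * R) = ratModel P * ratModel R := by
  simp [ratModel, Polynomial.map_mul]

/-- `(P : ℤ[X][X]) (n : ℕ) : ratModel (P ^ n) = ratModel P ^ n`. -/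
@[simp] theorem ratModel_pow (P : ℤ[X][X]) (n : ℕ) : ratModel (P ^ n) = ratModel P ^ n := by
  simp [ratModel, Polynomial.map_pow]

/-- `(P R : ℤ[X][X]) : ratModel (P + R) = ratModel P + ratModel R`. -/
@[simp] theorem ratModel_add (P R : ℤ[X][X]) : ratModel (P + R) = ratModel P + ratModel R := by
  simp [ratModel, Polynomial.map_add]

/-- `(P R : ℤ[X][X]) : ratModel (P - R) = ratModel P - ratModel R`. -/
@[simp] theorem ratModel_sub (P R : ℤ[X][X]) : ratModel (P - R) = ratModel P - ratModel R := by
  simp [ratModel]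

/-- `(P : ℤ[X][X]) : ratModel (-P) = -ratModel P`. -/
@[simp] theorem ratModel_neg (P : ℤ[X][X]) : ratModel (-P) = -ratModel P := by simp [ratModel]

/-- `: ratModel 0 = 0`. -/
@[simp] theorem ratModel_zero : ratModel 0 = 0 := by simp [ratModel]

/-- `: ratModel 1 = 1`. -/
@[simp] theorem ratModel_one : ratModel 1 = 1 := by simp [ratModel]

/-- `: ratModel X = X`. -/
@[simp] theorem ratModel_X : ratModel X = X := by simp [ratModel]

/-- `(p : ℤ[X]) : ratModel (C p) = C (p.map (Int.castRingHom ℚ))`. -/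
@[simp] theorem ratModel_C (p : ℤ[X]) : ratModel (C p) = C (p.map (Int.castRingHom ℚ)) := by
  simp [ratModel]

/-- `{ι : Type*} (s : Finset ι) (f : ι → ℤ[X][X]) : ratModel (∑ i ∈ s, f i) = ∑ i ∈ s, ratModel (f i)`. -/
theorem ratModel_sum {ι : Type*} (s : Finset ι) (f : ι → ℤ[X][X]) :
    ratModel (∑ i ∈ s, f i) = ∑ i ∈ s, ratModel (f i) := by
  simp [ratModel, Polynomial.map_sum]

/-- the tree's real evaluation `bev` at a rational point is the cast of the `ℚ`-model's value (cf. tree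
`RootDecomp1KSiegelBridge.bev_ratCast`, re-proved here to keep the import cone at `HeightGrading02`). -/
theorem bev_ratCast (P : ℤ[X][X]) (x y : ℚ) :
    bev P (x : ℝ) (y : ℝ) = (((ratModel P).evalEval x y : ℚ) : ℝ) := by
  unfold bev ratModel
  induction P using Polynomial.induction_on' with
  | add p q hp hq => simp only [Polynomial.map_add, eval_add, evalEval_add, hp, hq, Rat.cast_add]
  | monomial n p =>
    simp only [Polynomial.map_monomial, eval_monomial, evalEval, eval_mul, eval_pow, eval_C, Rat.cast_mul,
      Rat.cast_pow, RingHom.coe_coe, AlgHom.toRingHom_eq_coe, coe_mapRingHom, eval_map]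
    congr 1
    have h := Polynomial.aeval_algebraMap_apply ℝ x p
    rw [aeval_def, algebraMap_int_eq] at h
    simpa [aeval_def] using h

/-- `bev P x y = 0 ↔ (ratModel P)(x, y) = 0` at rational points. -/
theorem bev_eq_zero_iff_ratModel (P : ℤ[X][X]) (x y : ℚ) :
    bev P x y = 0 ↔ (ratModel P).evalEval x y = 0 := by
  rw [bev_ratCast]; exact_mod_cast Iff.rfl

/-- degree bookkeeping for the `ℚ`-model (inputs of the weak Bézout bound). -/
theorem natDegree_ratModel_le (R : ℤ[X][X]) : (ratModel R).natDegree ≤ R.natDegree + xdeg R :=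
  natDegree_map_le.trans (Nat.le_add_right _ _)

/-- `(R : ℤ[X][X]) (i : ℕ) : ((ratModel R).coeff i).natDegree ≤ R.natDegree + xdeg R`. -/
theorem natDegree_coeff_ratModel_le (R : ℤ[X][X]) (i : ℕ) :
    ((ratModel R).coeff i).natDegree ≤ R.natDegree + xdeg R := by
  rw [ratModel, coeff_map]
  exact natDegree_map_le.trans ((natDegree_coeff_le_xdeg R i).trans (Nat.le_add_left _ _))

/-- the value of the relation polynomial at a rational point. -/
theorem evalEval_ratModel_relPoly (m : ℕ) (D : ℤ) (χ : ℕ → ℤ[X]) (G H : ℤ[X][X]) (x y : ℚ) :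
    (ratModel (relPoly m D χ G H)).evalEval x y =
      (D : ℚ) * ((ratModel G).evalEval x y) ^ m +
        ∑ i ∈ Finset.Icc 1 m, (aeval x (χ i) : ℚ) * ((ratModel G).evalEval x y) ^ (m - i) *
          ((ratModel H).evalEval x y) ^ i := by
  unfold relPoly
  simp only [ratModel_add, ratModel_mul, ratModel_pow, ratModel_sum, ratModel_C, evalEval_add, evalEval_mul,
    evalEval_pow, evalEval_finsetSum, evalEval_C, eq_intCast, eval_map, aeval_def, algebraMap_int_eq]
  congr 2
  rw [← C_eq_intCast, eval₂_C, eq_intCast]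
  rfl

end Summit.Schanuel.Schanuel.Theorems.RootDecomp1KSiegelFunctions
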